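import Mathlib
import HarnessLib

/-!
# Route `F4SubCurvatureDoor`, crux `SubCurvatureKernel` ⟨stmt-QuantumFields-23036⟩ — FLAT VANISHING of off-diagonal test functions at the
# diagonal (clause (K) of the soft half, the estimate against the `‖x₀ − x₁‖⁻⁸` kernel bound)

Helper file (`--supports stmt-QuantumFields-23036 --as helper`; free-hands seat `ym-line-frs-p2` g17).  GENERIC (Schwartz functions on `(ℝ⁴)²`),
Mathlib only, definition-free, 0 sorry, standard axioms.  No item is closed; no summit, no crux and no mass gap is proved by this file.

WHAT.  The representation clause of `SubCurvatureKernel` quantifies over ALL compactly supported OFF-DIAGONAL test functions `F` (all derivatives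
vanish on the coincidence locus `x₀ = x₁`), whose supports may TOUCH the diagonal, while the extracted kernel only obeys `‖K(u)‖ ≲ ‖u‖⁻⁸` there
(✓`exists_gluedKernel_of_offDiagLimitAlong`).  Integrability of `K(x₀ − x₁) F(x)` therefore needs the quantitative flat vanishing proved here:

* `iteratedDeriv_line` — derivatives of a Schwartz function along an affine line `s ↦ p + s•h` are its iterated Fréchet derivatives at `(h,…,h)`;
* ★ `norm_le_of_flat` — if all derivatives of `F : 𝓢((ℝ⁴)², ℂ)` of order `≤ 8` vanish at the diagonal point `(x₁, x₁)` and `‖x₀ − x₁‖ ≤ 1`, then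
  `‖F x‖ ≤ 4ᵏ · S_{k,8}(F) · ‖x₀ − x₁‖⁸ · (1 + ‖x‖)⁻ᵏ` with `S_{k,8}` the sup of the Schwartz seminorms of index `≤ (k,8)` (Taylor with remainder
  along the segment from `(x₁,x₁)` to `x`, Mathlib `taylor_mean_remainder_bound`, and the Schwartz decay of the `8`-th derivative ON the segment,
  which stays within distance `1` of `x`).

HONEST LABEL: an estimate toward clause (K) of the SOFT half of ⟨23036⟩; ⟨23036⟩ is an open problem (AF clause untouched); the Yang–Mills mass gap is
NOT proved; no summit is proved by a line.
-/

set_option autoImplicit false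

noncomputable section

open scoped SchwartzMap BigOperators ContDiff
open MeasureTheory Filter Topology Set

namespace Summit.QuantumFields.YangMills.Theorems.F4SubCurvatureDoorSubCurvatureKernelFlat

/-- Derivatives along an affine line are iterated Fréchet derivatives evaluated at the constant direction. [folklore] -/
theorem iteratedDeriv_line (F : 𝓢((Fin 2 → EuclideanSpace ℝ (Fin 4)), ℂ)) (p h : Fin 2 → EuclideanSpace ℝ (Fin 4)) (i : ℕ) (s : ℝ) :
    iteratedDeriv i (fun s : ℝ => F (p + s • h)) s = iteratedFDeriv ℝ i (F : _ → ℂ) (p + s • h) (fun _ => h) := by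
  set L : ℝ →L[ℝ] (Fin 2 → EuclideanSpace ℝ (Fin 4)) := ContinuousLinearMap.toSpanSingleton ℝ h with hL
  have hcomp : (fun s : ℝ => F (p + s • h)) = (fun z => F (p + z)) ∘ L := by
    funext s; simp [hL, ContinuousLinearMap.toSpanSingleton_apply]
  have hF : ContDiff ℝ i (fun z : Fin 2 → EuclideanSpace ℝ (Fin 4) => F (p + z)) :=
    (F.smooth i).comp (contDiff_const.add contDiff_id)
  rw [iteratedDeriv_eq_iteratedFDeriv, hcomp, L.iteratedFDeriv_comp_right hF s le_rfl,
    ContinuousMultilinearMap.compContinuousLinearMap_apply, iteratedFDeriv_comp_add_left]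
  simp [hL, ContinuousLinearMap.toSpanSingleton_apply]

/-- ★ **FLAT VANISHING AT THE DIAGONAL, quantitative.**  Let `F : 𝓢((ℝ⁴)², ℂ)` have all derivatives of order `≤ 8` vanishing at the diagonal point
`(x₁, x₁)` and let `‖x₀ − x₁‖ ≤ 1`.  Then `‖F x‖ ≤ 4ᵏ S_{k,8}(F) ‖x₀ − x₁‖⁸ (1 + ‖x‖)⁻ᵏ`. [folklore; Hörmander ALPDO I, Thm 1.1.9 (Taylor)] -/
theorem norm_le_of_flat (F : 𝓢((Fin 2 → EuclideanSpace ℝ (Fin 4)), ℂ)) (k : ℕ) (x : Fin 2 → EuclideanSpace ℝ (Fin 4))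
    (hflat : ∀ i ≤ 8, iteratedFDeriv ℝ i (F : _ → ℂ) (fun _ => x 1) = 0) (hx : ‖x 0 - x 1‖ ≤ 1) :
    ‖F x‖ ≤ 4 ^ k * (Finset.Iic (k, 8)).sup (fun m => SchwartzMap.seminorm ℝ m.1 m.2) F * ‖x 0 - x 1‖ ^ 8 * ((1 + ‖x‖) ^ k)⁻¹ := by
  -- the base point, the direction and the line
  set p : Fin 2 → EuclideanSpace ℝ (Fin 4) := fun _ => x 1 with hp
  set h : Fin 2 → EuclideanSpace ℝ (Fin 4) := x - p with hh
  have hh_norm : ‖h‖ ≤ ‖x 0 - x 1‖ := by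
    refine (pi_norm_le_iff_of_nonneg (norm_nonneg _)).2 fun i => ?_
    fin_cases i
    · simp [hh, hp]
    · simp [hh, hp]
  have hph : p + (1 : ℝ) • h = x := by simp [hh]
  set g : ℝ → ℂ := fun s => F (p + s • h) with hg
  have hg_smooth : ContDiff ℝ (7 + 1 : ℕ) g := (F.smooth _).comp (contDiff_const.add (contDiff_id.smul contDiff_const))
  -- the sup of the seminorms and the decay of the 8-th derivative on the segment
  set S : ℝ := (Finset.Iic (k, 8)).sup (fun m => SchwartzMap.seminorm ℝ m.1 m.2) F with hS
  have hS0 : 0 ≤ S := by positivity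
  have hxpos : 0 < 1 + ‖x‖ := by positivity
  have hseg : ∀ s ∈ Icc (0 : ℝ) 1, (1 + ‖x‖) ≤ 2 * (1 + ‖p + s • h‖) := by
    intro s hs
    have h1 : ‖x - (p + s • h)‖ ≤ 1 := by
      have : x - (p + s • h) = (1 - s) • h := by rw [← hph]; module
      rw [this, norm_smul, Real.norm_eq_abs, abs_of_nonneg (by linarith [hs.2])]
      calc (1 - s) * ‖h‖ ≤ 1 * 1 := mul_le_mul (by linarith [hs.1]) (hh_norm.trans hx) (norm_nonneg _) zero_le_one
        _ = 1 := one_mul 1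
    have h2 : ‖x‖ ≤ ‖p + s • h‖ + 1 := by
      calc ‖x‖ = ‖(p + s • h) + (x - (p + s • h))‖ := by congr 1; abel
        _ ≤ ‖p + s • h‖ + ‖x - (p + s • h)‖ := norm_add_le _ _
        _ ≤ ‖p + s • h‖ + 1 := by linarith
    linarith [norm_nonneg (p + s • h)]
  have hD8 : ∀ s ∈ Icc (0 : ℝ) 1, ‖iteratedFDeriv ℝ 8 (F : _ → ℂ) (p + s • h)‖ ≤ 4 ^ k * S * ((1 + ‖x‖) ^ k)⁻¹ := by
    intro s hs
    have h1 := SchwartzMap.one_add_le_sup_seminorm_apply (𝕜 := ℝ) (m := (k, 8)) le_rfl le_rfl F (p + s • h)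
    -- `(1 + ‖y‖)^k ‖D⁸F y‖ ≤ 2^k S` and `(1+‖x‖) ≤ 2(1+‖y‖)`
    have hy : 0 < 1 + ‖p + s • h‖ := by positivity
    have h2 : (1 + ‖x‖) ^ k ≤ 2 ^ k * (1 + ‖p + s • h‖) ^ k := by
      rw [← mul_pow]; exact pow_le_pow_left₀ hxpos.le (hseg s hs) k
    rw [← hS] at h1
    have h3 : (1 + ‖x‖) ^ k * ‖iteratedFDeriv ℝ 8 (F : _ → ℂ) (p + s • h)‖ ≤ 4 ^ k * S := by
      calc (1 + ‖x‖) ^ k * ‖iteratedFDeriv ℝ 8 (F : _ → ℂ) (p + s • h)‖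
          ≤ 2 ^ k * (1 + ‖p + s • h‖) ^ k * ‖iteratedFDeriv ℝ 8 (F : _ → ℂ) (p + s • h)‖ :=
            mul_le_mul_of_nonneg_right h2 (norm_nonneg _)
        _ = 2 ^ k * ((1 + ‖p + s • h‖) ^ k * ‖iteratedFDeriv ℝ 8 (F : _ → ℂ) (p + s • h)‖) := by ring
        _ ≤ 2 ^ k * (2 ^ k * S) := mul_le_mul_of_nonneg_left h1 (by positivity)
        _ = 4 ^ k * S := by rw [← mul_assoc, ← mul_pow]; norm_num
    rw [le_mul_inv_iff₀ (pow_pos hxpos k), mul_comm]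
    exact h3
  -- the Taylor bound along the segment: all derivatives of `g` of order `≤ 7` vanish at `0`
  have hderiv0 : ∀ i ≤ 7, iteratedDerivWithin i g (Icc 0 1) 0 = 0 := by
    intro i hi
    have hgi : ContDiff ℝ i g := (F.smooth i).comp (contDiff_const.add (contDiff_id.smul contDiff_const))
    rw [iteratedDerivWithin_eq_iteratedDeriv (uniqueDiffOn_Icc zero_lt_one) hgi.contDiffAt (left_mem_Icc.2 zero_le_one),
      hg, iteratedDeriv_line]
    simp only [zero_smul, add_zero]
    rw [hflat i (by omega)]
    rfl
  have htaylor0 : taylorWithinEval g 7 (Icc 0 1) 0 1 = 0 := by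
    rw [taylor_within_apply]
    refine Finset.sum_eq_zero fun i hi => ?_
    rw [hderiv0 i (by simpa [Finset.mem_range, Nat.lt_succ_iff] using hi), smul_zero]
  have hC : ∀ y ∈ Icc (0 : ℝ) 1, ‖iteratedDerivWithin (7 + 1) g (Icc 0 1) y‖ ≤
      4 ^ k * S * ((1 + ‖x‖) ^ k)⁻¹ * ‖x 0 - x 1‖ ^ 8 := by
    intro y hy
    rw [iteratedDerivWithin_eq_iteratedDeriv (uniqueDiffOn_Icc zero_lt_one)
      (hg_smooth.contDiffAt) hy, hg, iteratedDeriv_line]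
    calc ‖iteratedFDeriv ℝ (7 + 1) (F : _ → ℂ) (p + y • h) fun _ => h‖
        ≤ ‖iteratedFDeriv ℝ (7 + 1) (F : _ → ℂ) (p + y • h)‖ * ∏ _i : Fin (7 + 1), ‖h‖ :=
          ContinuousMultilinearMap.le_opNorm _ _
      _ = ‖iteratedFDeriv ℝ 8 (F : _ → ℂ) (p + y • h)‖ * ‖h‖ ^ 8 := by rw [Finset.prod_const, Finset.card_fin]
      _ ≤ 4 ^ k * S * ((1 + ‖x‖) ^ k)⁻¹ * ‖x 0 - x 1‖ ^ 8 :=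
          mul_le_mul (hD8 y hy) (pow_le_pow_left₀ (norm_nonneg _) hh_norm 8) (by positivity) (by positivity)
  have hmain := taylor_mean_remainder_bound (f := g) (a := 0) (b := 1) (n := 7) zero_le_one
    (hg_smooth.contDiffOn) (right_mem_Icc.2 zero_le_one) hC
  rw [htaylor0, sub_zero, sub_zero, one_pow, mul_one] at hmain
  have hg1 : g 1 = F x := by simp only [hg, hph]
  rw [hg1] at hmain
  calc ‖F x‖ ≤ 4 ^ k * S * ((1 + ‖x‖) ^ k)⁻¹ * ‖x 0 - x 1‖ ^ 8 / (7 : ℕ).factorial := hmain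
    _ ≤ 4 ^ k * S * ((1 + ‖x‖) ^ k)⁻¹ * ‖x 0 - x 1‖ ^ 8 := by
        refine div_le_self (by positivity) ?_
        exact_mod_cast Nat.one_le_iff_ne_zero.2 (Nat.factorial_ne_zero 7)
    _ = 4 ^ k * S * ‖x 0 - x 1‖ ^ 8 * ((1 + ‖x‖) ^ k)⁻¹ := by ring

end Summit.QuantumFields.YangMills.Theorems.F4SubCurvatureDoorSubCurvatureKernelFlat

end
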